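import Summits.BirchSwinnertonDyer.BirchSwinnertonDyer.Theorems.KimAtThreeDeepUpperKolyvaginAdditiveThree
import HarnessLib

/-!
# THEOREM D-u for `𝓕_can` on `E[3^k·3]` at ANY reduction type at `3`: the place `3` paid by a deeper
# family of depth `k + N₀`, `N₀` a `3`-power torsion-stabilisation level of `E(ℚ₃)` (cell `bsd-addord`,
# seat w2-c3 gen 6; route W2 `KimAtThreeKolyvagin`, crux 19076 `DeepUpperAtThree`, off-stratum child
# 19562 `DeepUpperAtThreeOffKatoStratum` — its NON-ADDITIVE rows: good / multiplicative reduction at `3`)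

HONEST FRAMING: TOOL theorems (no definition, no named fact, no `sorry`); close nothing by themselves;
nothing is booked; BSD is not proved by any of this.

## What, and why

Seat gen 5's `KimAtThreeDeepUpperKolyvaginAdditiveThree` (p472529) proves THEOREM D-u — Kato's Euler
system gives a Kolyvagin system for `(E[3^{k+1}], 𝓕_can, 𝒫)` with every bad place `w ≠ 3` paid by the
(C2) clause of `ZetaBody` (classes unramified as `T`-classes) — on the rows ADDITIVE at `3`, where the
place `3` is paid by a DEEPER derivative family of depth `m ≥ k + 2`: additivity enters ONLY through
n1011-p13's `hstab_two_of_hasAdditiveReductionAt` (`27·P = 0 → 9·P = 0` on `E(ℚ₃)`), which feeds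
T-DER-BP FILE 2 `localization_map_red_mem_propagatedSelmerStructure_three` at `N₀ = 2`.  That FILE 2 is
typed for an ARBITRARY torsion-stabilisation level `N₀` (`hstab : 3^{N₀+1}·P = 0 → 3^{N₀}·P = 0` on
`E(ℚ_v)`, Mazur–Rubin Prop. A.2 with the depth explicit), and such an `N₀` always exists
(`exists_torsion_stable`: the `3`-power torsion of `E(ℚ₃)` is finite).  This file re-keys the chain on
`hstab` instead of `hadd`, so that THEOREM D-u holds at EVERY reduction type at `3` — the input the
non-additive rows of crux 19562 need for the Kolyvagin-system road (seat w2-acc1's reduction-type-free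
END `KimAtThreeDeepUpperOffStratumPortEDeep.deepUpper_conclusion_of_port_e_deep`):

* §1 `localization_mem_propagatedSelmerStructure_three_of_res_eq_deriv_of_stable` — n1011-p13's
  `CoeffChange.EC.localization_mem_propagatedSelmerStructure_three_of_res_eq_deriv_of_hasAdditiveReductionAt`
  with (`hadd`, `k + 2 ≤ m`) replaced by (`hstab` at level `N₀`, `k + N₀ ≤ m`): THE derivative class of
  depth `3^{k+1}` localises into `𝓕_can(E[3^k·3])₃` because it is the reduction of the depth-`3^{m+1}`
  class (`CoeffChange.EC.map_eq_of_res_eq_deriv`) and FILE 2.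
* §2 `exists_isKolyvaginSystem_propagatedSelmerStructure_three_of_stable_of_unramified` (+ its
  `E[3^{k+1}]_{ℤ₃}` reading `…_torsionCoeff_of_stable_of_unramified`) — gen 5's D-u theorems with `hadd`
  replaced by `hstab`, depth `k + N₀ ≤ m`, Kolyvagin primes of level `m + 1`; every other binder and the
  conclusion token for token.
`hstab` holds for SOME `N₀` always (`exists_torsion_stable`), with `N₀ = 2` on additive rows (gen 5's
case) and `N₀ = 0` when `E(ℚ₃)[3] = 0`.  References: Mazur–Rubin, Mem. AMS 799 (2004) Thm. 3.2.4, App. A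
Prop. A.2 / Rem. A.5; Rubin, *Euler Systems* (2000) 4.4.10, 4.5.1, 4.5.4; Kato, Astérisque 295 (2004)
(8.1.3); Sakamoto, JTNB 36 (2024) Def. 4.1; HOME/w2c3/W2C3-D7U-CHAIN-g5.md.
-/

noncomputable section
-- the cell's Theorems namespace `Summit.BirchSwinnertonDyer.BirchSwinnertonDyer.…` repeats the summit name by design (D-0017)
set_option linter.dupNamespace false

open CategoryTheory Function Finset Polynomial Field IsDedekindDomain NumberField
open scoped NumberField Classical ContRepresentation
open Literature.NumberTheory.GaloisRepresentations Literature.NumberTheory.EllipticCurves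
open Literature.NumberTheory.GaloisRepresentations.DiscreteGaloisModule
open Literature.NumberTheory.GaloisCohomology
open Summit.BirchSwinnertonDyer.Rank1Residual.GaloisImage
open Summit.BirchSwinnertonDyer.Rank1Residual.GaloisImage.CoeffTransport
open Summit.BirchSwinnertonDyer.Rank1Residual.GaloisImage.CyclotomicLevel
open Summit.BirchSwinnertonDyer.Rank1Residual.GaloisImage.TorsionCoeff
open Summit.BirchSwinnertonDyer.Rank1Residual.GaloisImage.Derivative
open Summit.BirchSwinnertonDyer.Rank1Residual.GaloisImage.Derivative.Rat
open Summit.BirchSwinnertonDyer.BirchSwinnertonDyer.Theorems.KimAtThreeDeepUpperBadPlaceClause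
open Rat.HeightOneSpectrum WeierstrassCurve TateModule

namespace Summit.BirchSwinnertonDyer.BirchSwinnertonDyer.Theorems.KimAtThreeDeepUpperKolyvaginStableThree

/-! ### §1 The depth-`3^{k+1}` derivative class localises into `𝓕_can` at `3`, given `hstab` -/

/-- **THEOREM B of row T-DER at the place `3` for Kolyvagin's derivative class of depth `3^{k+1}`, at ANY
reduction type**, under the torsion-stabilisation binder `hstab` of level `N₀` on `E(ℚ_v)`, `v ∣ 3`, and
depths `k + N₀ ≤ m`: THE derivative class `κ_k` of depth `3^{k+1}` (`res_U κ_k = D_r (Ψ_k c)`, unique)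
has `loc₃ κ_k ∈ 𝓕_can(E[3^k·3])₃`, because `κ_k = r_* κ_m` for the depth-`3^{m+1}` class
(`CoeffChange.EC.map_eq_of_res_eq_deriv`) and every reduction from depth `≥ k + N₀` lands in the
propagated condition (T-DER-BP FILE 2 `localization_map_red_mem_propagatedSelmerStructure_three`).
n1011-p13's additive statement is the case `N₀ = 2`. [cite: MazurRubin2004, App. A, Prop. A.2 (p. 79) and its proof (p. 80)] -/
theorem localization_mem_propagatedSelmerStructure_three_of_res_eq_deriv_of_stable
    (W : WeierstrassCurve ℚ) [W.IsElliptic] [ContinuousSMul ℤ_[3] (W.tateModule 3)]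
    (h : Continuous fun x : absoluteGaloisGroup ℚ × W.tateModule 3 => W.galoisRepTate 3 x.1 x.2)
    {v : HeightOneSpectrum (𝓞 ℚ)} {N₀ : ℕ}
    (hstab : ∀ P : (W.baseChange (v.adicCompletion ℚ)).toAffine.Point,
      3 ^ (N₀ + 1) • P = 0 → 3 ^ N₀ • P = 0)
    {k m : ℕ} (hkm : k + N₀ ≤ m)
    (r : (W.torsionGaloisModule (((3 : ℕ) : ℤ) ^ m * ((3 : ℕ) : ℤ))).toContRepresentation →ⁱL
      (W.torsionGaloisModule (((3 : ℕ) : ℤ) ^ k * ((3 : ℕ) : ℤ))).toContRepresentation)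
    (hr : ∀ x : geomTorsion W (((3 : ℕ) : ℤ) ^ m * ((3 : ℕ) : ℤ)),
      ((r x : geomTorsion W (((3 : ℕ) : ℤ) ^ k * ((3 : ℕ) : ℤ))) : geomPoints W) =
        (((3 : ℕ) : ℤ) ^ (m - k)) • (x : geomPoints W))
    (U : Subgroup (absoluteGaloisGroup ℚ)) [U.Normal] {ι : Type*} (σ : ι → absoluteGaloisGroup ℚ)
    (N : ι → ℕ) (rr : Finset ι) (commm) (commk)
    (c : continuousCohomology 1 (subgroupRep (W.tateGaloisRep 3 h).toTopRep U))
    (Ψm : continuousCohomology 1 (subgroupRep (W.tateGaloisRep 3 h).toTopRep U) →+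
      continuousCohomology 1
        (subgroupRep (W.torsionGaloisModule (((3 : ℕ) : ℤ) ^ m * ((3 : ℕ) : ℤ))).toTopRep U))
    (hΨm : ∀ (φ : contOneCocycles (subgroupRep (W.tateGaloisRep 3 h).toTopRep U))
      (ψ : contOneCocycles
        (subgroupRep (W.torsionGaloisModule (((3 : ℕ) : ℤ) ^ m * ((3 : ℕ) : ℤ))).toTopRep U)),
      (∀ g, ((ψ.1 g : geomTorsion W _) : geomPoints W) = proj 3 (m + 1) (φ.1 g)) →
        Ψm (oneCocycleClass _ φ) = oneCocycleClass _ ψ)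
    (Ψk : continuousCohomology 1 (subgroupRep (W.tateGaloisRep 3 h).toTopRep U) →+
      continuousCohomology 1
        (subgroupRep (W.torsionGaloisModule (((3 : ℕ) : ℤ) ^ k * ((3 : ℕ) : ℤ))).toTopRep U))
    (hΨk : ∀ (φ : contOneCocycles (subgroupRep (W.tateGaloisRep 3 h).toTopRep U))
      (ψ : contOneCocycles
        (subgroupRep (W.torsionGaloisModule (((3 : ℕ) : ℤ) ^ k * ((3 : ℕ) : ℤ))).toTopRep U)),
      (∀ g, ((ψ.1 g : geomTorsion W _) : geomPoints W) = proj 3 (k + 1) (φ.1 g)) →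
        Ψk (oneCocycleClass _ φ) = oneCocycleClass _ ψ)
    (κm : galoisCohomology (W.torsionGaloisModule (((3 : ℕ) : ℤ) ^ m * ((3 : ℕ) : ℤ))) 1)
    (hκm : resSubgroup (W.torsionGaloisModule (((3 : ℕ) : ℤ) ^ m * ((3 : ℕ) : ℤ))).toTopRep U 1 κm =
      (rr.noncommProd (fun ℓ => ∑ j ∈ Finset.range (N ℓ),
          (j : Module.End ℤ (continuousCohomology 1
            (subgroupRep (W.torsionGaloisModule (((3 : ℕ) : ℤ) ^ m * ((3 : ℕ) : ℤ))).toTopRep U))) *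
            (conjMap (W.torsionGaloisModule (((3 : ℕ) : ℤ) ^ m * ((3 : ℕ) : ℤ))).toTopRep U (σ ℓ)
              1).hom.toLinearMap ^ j) commm) (Ψm c))
    (huniq : ∃! κ' : galoisCohomology (W.torsionGaloisModule (((3 : ℕ) : ℤ) ^ k * ((3 : ℕ) : ℤ))) 1,
      resSubgroup (W.torsionGaloisModule (((3 : ℕ) : ℤ) ^ k * ((3 : ℕ) : ℤ))).toTopRep U 1 κ' =
      (rr.noncommProd (fun ℓ => ∑ j ∈ Finset.range (N ℓ),
          (j : Module.End ℤ (continuousCohomology 1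
            (subgroupRep (W.torsionGaloisModule (((3 : ℕ) : ℤ) ^ k * ((3 : ℕ) : ℤ))).toTopRep U))) *
            (conjMap (W.torsionGaloisModule (((3 : ℕ) : ℤ) ^ k * ((3 : ℕ) : ℤ))).toTopRep U (σ ℓ)
              1).hom.toLinearMap ^ j) commk) (Ψk c))
    (κk : galoisCohomology (W.torsionGaloisModule (((3 : ℕ) : ℤ) ^ k * ((3 : ℕ) : ℤ))) 1)
    (hκk : resSubgroup (W.torsionGaloisModule (((3 : ℕ) : ℤ) ^ k * ((3 : ℕ) : ℤ))).toTopRep U 1 κk =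
      (rr.noncommProd (fun ℓ => ∑ j ∈ Finset.range (N ℓ),
          (j : Module.End ℤ (continuousCohomology 1
            (subgroupRep (W.torsionGaloisModule (((3 : ℕ) : ℤ) ^ k * ((3 : ℕ) : ℤ))).toTopRep U))) *
            (conjMap (W.torsionGaloisModule (((3 : ℕ) : ℤ) ^ k * ((3 : ℕ) : ℤ))).toTopRep U (σ ℓ)
              1).hom.toLinearMap ^ j) commk) (Ψk c)) :
    galoisCohomology.localization (W.torsionGaloisModule (((3 : ℕ) : ℤ) ^ k * ((3 : ℕ) : ℤ)))
        (Sum.inr v : Place ℚ) 1 κk ∈ propagatedSelmerStructure W 3 k (Sum.inr v) := by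
  have hMm : geomTorsion W ((3 ^ (m + 1) : ℕ) : ℤ) = geomTorsion W (((3 : ℕ) : ℤ) ^ m * ((3 : ℕ) : ℤ)) := by
    rw [show (((3 : ℕ) : ℤ) ^ m * ((3 : ℕ) : ℤ)) = ((3 ^ (m + 1) : ℕ) : ℤ) by push_cast; ring]
  have hMk : geomTorsion W ((3 ^ (k + 1) : ℕ) : ℤ) = geomTorsion W (((3 : ℕ) : ℤ) ^ k * ((3 : ℕ) : ℤ)) := by
    rw [show (((3 : ℕ) : ℤ) ^ k * ((3 : ℕ) : ℤ)) = ((3 ^ (k + 1) : ℕ) : ℤ) by push_cast; ring]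
  have hκ := CoeffChange.EC.map_eq_of_res_eq_deriv W 3 h (by omega : k ≤ m) hMm hMk
    (TopRep.ofHom ⟨r.toContinuousLinearMap, r.isIntertwining'⟩) (fun x => hr x) U σ N rr commm commk c
    Ψm hΨm Ψk hΨk κm hκm huniq κk hκk
  rw [← hκ]
  exact localization_map_red_mem_propagatedSelmerStructure_three W v hstab k m hkm r hr κm

/-! ### §2 THEOREM D-u at any reduction type at `3` -/

variable (W : WeierstrassCurve ℚ) [W.IsElliptic] [W.IsGloballyMinimal]
variable [Module.Free ℤ_[3] (W.tateModule 3)] [Module.Finite ℤ_[3] (W.tateModule 3)]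
  [ContinuousSMul ℤ_[3] (W.tateModule 3)]

/-- Local notation: `T∞ = T₃ E` as a continuous `G_ℚ`-representation. -/
local notation3 "T∞" => WeierstrassCurve.tateGaloisRep W 3 (W.continuous_galoisRepTate_holds 3)

/-- Local notation: `𝐫⟦f, T′, U⟧ = f_* : H¹(U, T₃E) → H¹(U, T′)`. -/
local notation3 (prettyPrint := false) "𝐫⟦" f ", " Tg ", " U "⟧" =>
  ContinuousCohomology.map (ContinuousMonoidHom.id _)
    (X := subgroupRep (ContinuousRep.toTopRep T∞) U)
    (Y := subgroupRep (ContinuousRep.toTopRep Tg) U)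
    ((TopRep.resFunctor (Subgroup.subtype U)).map f) 1

variable (S : Set (HeightOneSpectrum (𝓞 ℚ)))

/-- Local notation: `𝓛` = the cyclotomic Euler-system levels `ℚ(μ_{3^{n+1}}, μ_r)`, `r ∩ S = ∅`. -/
local notation3 "𝓛" => cyclotomicLevelsRat 3 S

/-- Local notation: `𝐃⟦A, X, U, τ⟧ ℓ = ∑_{j < ℓ−1} j·(τ_ℓ)_*^j`, Kolyvagin's derivative operator. -/
local notation3 (prettyPrint := false) "𝐃⟦" A ", " X ", " U ", " τ "⟧" =>
  fun ℓ : HeightOneSpectrum (𝓞 ℚ) =>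
  ∑ j ∈ Finset.range (((primesEquiv ℓ : Nat.Primes) : ℕ) - 1),
    (j : Module.End A (continuousCohomology 1 (subgroupRep X U))) *
      (conjMap X U ((τ : HeightOneSpectrum (𝓞 ℚ) → absoluteGaloisGroup ℚ) ℓ) 1).hom.toLinearMap ^ j

/-- Local notation: `𝐃ℤ⟦X, U, τ⟧ ℓ` — the `ℤ`-linear derivative operator (D6b's spelling). -/
local notation3 (prettyPrint := false) "𝐃ℤ⟦" X ", " U ", " τ "⟧" =>
  fun ℓ : HeightOneSpectrum (𝓞 ℚ) =>
  ∑ j ∈ Finset.range (((primesEquiv ℓ : Nat.Primes) : ℕ) - 1),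
    (j : Module.End ℤ (continuousCohomology 1 (subgroupRep X U))) *
      (conjMap X U ((τ : HeightOneSpectrum (𝓞 ℚ) → absoluteGaloisGroup ℚ) ℓ) 1).hom.toLinearMap ^ j

/-- Local notation: the level-`j` reduction `red_j : T₃E ⟶ E[3^j]_{ℤ₃}` (GZ-2). -/
local notation3 "𝐫𝐞𝐝⟦" j "⟧" => tateModuleRed W 3 (W.continuous_galoisRepTate_holds 3) j

/-- **THEOREM D-u for `𝓕_can` on `E[3^k·3]` at ANY reduction type at `3`, NO `hbad`**: gen 5's
`exists_isKolyvaginSystem_propagatedSelmerStructure_three_of_hasAdditiveReductionAt_of_unramified` with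
the additive-reduction binder `hadd` REPLACED by the torsion-stabilisation binder `hstab` of level `N₀` at
the place(s) over `3` and the depth condition `k + 2 ≤ m` by `k + N₀ ≤ m`; the place `3` is paid by the
depth-`m` family (§1), every bad `w ≠ 3` by THEOREM B-u (`hur` = ZetaBody's (C2)).
[cite: MazurRubin2004, App. A Prop. A.2, Remark A.5 and Thm. 3.2.4] [cite: Rubin2000, Def. 4.4.10, Thm. 4.5.1 and Thm. 4.5.4]
[cite: Kato2004Asterisque, (8.1.3) (p. 180)] [cite: Sakamoto2024, Def. 4.1 (p. 926)] -/
theorem exists_isKolyvaginSystem_propagatedSelmerStructure_three_of_stable_of_unramified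
    {c : ∀ (i : ℕ) (r : (𝓛).Ideals), H1 T∞ ((𝓛).level i r.1)}
    (hc : IsEulerSystem 𝓛 T∞ 3 c)
    {k m N₀ : ℕ} (hkm : k + N₀ ≤ m)
    -- the depth-`k` coefficient system
    {M' : Type} [AddCommGroup M'] [Module ℤ_[3] M'] [TopologicalSpace M'] [DiscreteTopology M']
    [IsTopologicalAddGroup M'] [ContinuousSMul ℤ_[3] M'] {T' : GaloisRep ℚ ℤ_[3] M'}
    (red : T∞.toTopRep ⟶ T'.toTopRep) (hred : Function.Surjective red.hom)
    (hM : ∀ x : M', (((3 : ℕ) : ℤ_[3]) ^ (k + 1)) • x = 0)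
    (e : M' →+ WeierstrassCurve.geomTorsion W (((3 : ℕ) : ℤ) ^ k * ((3 : ℕ) : ℤ))) (hec : Continuous e)
    (he : ∀ (g : absoluteGaloisGroup ℚ) (x : M'),
      e (T'.toTopRep.ρ g x) = (W.torsionGaloisModule (((3 : ℕ) : ℤ) ^ k * ((3 : ℕ) : ℤ))).toTopRep.ρ g (e x))
    (einv : WeierstrassCurve.geomTorsion W (((3 : ℕ) : ℤ) ^ k * ((3 : ℕ) : ℤ)) →+ M') (hic : Continuous einv)
    (h₁ : ∀ x, einv (e x) = x) (h₂ : ∀ y, e (einv y) = y)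
    (hcomp : ∀ a : W.tateModule 3,
      ((e (red.hom a) : geomTorsion W (((3 : ℕ) : ℤ) ^ k * ((3 : ℕ) : ℤ))) : geomPoints W) = proj 3 (k + 1) a)
    -- the depth-`m` coefficient system
    {M'' : Type} [AddCommGroup M''] [Module ℤ_[3] M''] [TopologicalSpace M'']
    [IsTopologicalAddGroup M''] [ContinuousSMul ℤ_[3] M''] {T'' : GaloisRep ℚ ℤ_[3] M''}
    (red'' : T∞.toTopRep ⟶ T''.toTopRep) (hM'' : ∀ x : M'', (((3 : ℕ) : ℤ_[3]) ^ (m + 1)) • x = 0)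
    (e'' : M'' →+ WeierstrassCurve.geomTorsion W (((3 : ℕ) : ℤ) ^ m * ((3 : ℕ) : ℤ))) (hec'' : Continuous e'')
    (he'' : ∀ (g : absoluteGaloisGroup ℚ) (x : M''),
      e'' (T''.toTopRep.ρ g x) = (W.torsionGaloisModule (((3 : ℕ) : ℤ) ^ m * ((3 : ℕ) : ℤ))).toTopRep.ρ g (e'' x))
    (einv'' : WeierstrassCurve.geomTorsion W (((3 : ℕ) : ℤ) ^ m * ((3 : ℕ) : ℤ)) →+ M'') (hic'' : Continuous einv'')
    (h₁'' : ∀ x, einv'' (e'' x) = x) (h₂'' : ∀ y, e'' (einv'' y) = y)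
    (hcomp'' : ∀ a : W.tateModule 3,
      ((e'' (red''.hom a) : geomTorsion W (((3 : ℕ) : ℤ) ^ m * ((3 : ℕ) : ℤ))) : geomPoints W) = proj 3 (m + 1) a)
    -- the reduction `E[3^m·3] → E[3^k·3]`, `x ↦ 3^{m-k} x`
    (r : (W.torsionGaloisModule (((3 : ℕ) : ℤ) ^ m * ((3 : ℕ) : ℤ))).toContRepresentation →ⁱL
      (W.torsionGaloisModule (((3 : ℕ) : ℤ) ^ k * ((3 : ℕ) : ℤ))).toContRepresentation)
    (hr : ∀ x : geomTorsion W (((3 : ℕ) : ℤ) ^ m * ((3 : ℕ) : ℤ)),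
      ((r x : geomTorsion W (((3 : ℕ) : ℤ) ^ k * ((3 : ℕ) : ℤ))) : geomPoints W) =
        (((3 : ℕ) : ℤ) ^ (m - k)) • (x : geomPoints W))
    -- the curve and the datum
    (hirr : W.HasIrreducibleModPGaloisRep 3)
    (hstab : ∀ v : HeightOneSpectrum (𝓞 ℚ), ((primesEquiv v : Nat.Primes) : ℕ) = 3 →
      ∀ P : (W.baseChange (v.adicCompletion ℚ)).toAffine.Point, 3 ^ (N₀ + 1) • P = 0 → 3 ^ N₀ • P = 0)
    (D : KolyvaginDatum (W.torsionGaloisModule (((3 : ℕ) : ℤ) ^ k * ((3 : ℕ) : ℤ))))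
    (hT : D.transverse = cyclotomicTransverse (W.torsionGaloisModule (((3 : ℕ) : ℤ) ^ k * ((3 : ℕ) : ℤ))))
    {η : (ℓ : HeightOneSpectrum (𝓞 ℚ)) → (ZMod (Ideal.absNorm ℓ.asIdeal))ˣ}
    (hD : D.HasCanonicalComparison (3 ^ (k + 1)) η)
    (hPr : D.primes ⊆ (𝓛).primes)
    (hKol : ∀ ℓ ∈ D.primes, Kato.IsKolyvaginPrime W 3 (m + 1) ((primesEquiv ℓ : Nat.Primes) : ℕ))
    -- (C2): every class of the Euler system is UNRAMIFIED AWAY FROM `3` at class level (`ZetaBody` (C2))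
    (hur : ∀ (i : ℕ) (r : (𝓛).Ideals) (v : HeightOneSpectrum (𝓞 ℚ)), ((primesEquiv v : Nat.Primes) : ℕ) ≠ 3 →
      ∀ 𝔓 ∈ v.primesAbove,
        resLe (T∞).toTopRep
          (inf_le_left : (𝓛).level i r.1 ⊓ 𝔓.inertia (absoluteGaloisGroup ℚ) ≤ (𝓛).level i r.1) 1 (c i r) = 0) :
    ∃ (σ : HeightOneSpectrum (𝓞 ℚ) → absoluteGaloisGroup ℚ)
      (Φ : ∀ r : Finset (HeightOneSpectrum (𝓞 ℚ)),
        continuousCohomology 1 (subgroupRep T'.toTopRep ((𝓛).level ⊥ r)) →+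
          continuousCohomology 1 (subgroupRep
            (W.torsionGaloisModule (((3 : ℕ) : ℤ) ^ k * ((3 : ℕ) : ℤ))).toTopRep ((𝓛).level ⊥ r)))
      (comm : ∀ r : Finset (HeightOneSpectrum (𝓞 ℚ)),
        ((r : Finset _) : Set (HeightOneSpectrum (𝓞 ℚ))).Pairwise fun a b =>
          Commute (𝐃⟦ℤ, (W.torsionGaloisModule (((3 : ℕ) : ℤ) ^ k * ((3 : ℕ) : ℤ))).toTopRep, ((𝓛).level ⊥ r), σ⟧ a)
            (𝐃⟦ℤ, (W.torsionGaloisModule (((3 : ℕ) : ℤ) ^ k * ((3 : ℕ) : ℤ))).toTopRep, ((𝓛).level ⊥ r), σ⟧ b))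
      (κ : Finset (HeightOneSpectrum (𝓞 ℚ)) →
        galoisCohomology (W.torsionGaloisModule (((3 : ℕ) : ℤ) ^ k * ((3 : ℕ) : ℤ))) 1),
      (∀ ℓ, σ ℓ ∈ (adicCompletionPrime ℚ ℓ).inertia (absoluteGaloisGroup ℚ)) ∧
      (∀ ℓ, modNCyclotomicCharacter ℚ (Ideal.absNorm ℓ.asIdeal) (σ ℓ) = η ℓ) ∧
      (∀ r, ∀ (φ : contOneCocycles (subgroupRep T'.toTopRep ((𝓛).level ⊥ r)))
        (ψ : contOneCocycles (subgroupRep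
          (W.torsionGaloisModule (((3 : ℕ) : ℤ) ^ k * ((3 : ℕ) : ℤ))).toTopRep ((𝓛).level ⊥ r))),
        (∀ g, ψ.1 g = e (φ.1 g)) → Φ r (oneCocycleClass _ φ) = oneCocycleClass _ ψ) ∧
      D.IsKolyvaginSystem (propagatedSelmerStructure W 3 k) κ ∧
      (∀ r : Finset (HeightOneSpectrum (𝓞 ℚ)), ¬ (↑r : Set _) ⊆ D.primes → κ r = 0) ∧
      ∀ (r : Finset (HeightOneSpectrum (𝓞 ℚ))) (hr : (↑r : Set _) ⊆ D.primes),
        resSubgroup (W.torsionGaloisModule (((3 : ℕ) : ℤ) ^ k * ((3 : ℕ) : ℤ))).toTopRep ((𝓛).level ⊥ r) 1 (κ r) =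
          (r.noncommProd 𝐃⟦ℤ, (W.torsionGaloisModule (((3 : ℕ) : ℤ) ^ k * ((3 : ℕ) : ℤ))).toTopRep,
              ((𝓛).level ⊥ r), σ⟧ (comm r))
            (Φ r (𝐫⟦red, T', ((𝓛).level ⊥ r)⟧
              (c ⊥ ⟨r, fun _ hq => hPr (hr (Finset.mem_coe.2 hq))⟩))) := by
  have hmk : ((3 : ℕ) : ℤ) ^ k * ((3 : ℕ) : ℤ) = ((3 ^ (k + 1) : ℕ) : ℤ) := by push_cast; ring
  have hmm : ((3 : ℕ) : ℤ) ^ m * ((3 : ℕ) : ℤ) = ((3 ^ (m + 1) : ℕ) : ℤ) := by push_cast; ring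
  have hKolk : ∀ ℓ ∈ D.primes, Kato.IsKolyvaginPrime W 3 (k + 1) ((primesEquiv ℓ : Nat.Primes) : ℕ) :=
    fun ℓ hℓ => (hKol ℓ hℓ).mono (by omega)
  -- arithmetic Frobenii at every place (THEOREM B-u's `Fr`)
  have hFrex : ∀ ℓ : HeightOneSpectrum (𝓞 ℚ), ∃ Fr : absoluteGaloisGroup ℚ, IsArithFrobAtPlace ℚ ℓ Fr :=
    fun ℓ => (CyclotomicLevel.Rat.exists_isArithFrobAtPlace_mem_tameLevel 3 S ℓ).imp fun _ h => h.1
  choose Fr hFr using hFrex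
  -- the generators (D1)
  obtain ⟨σ, hσI, hσχ, -, hσ⟩ := CyclotomicLevel.Rat.exists_sigma_mem_inertia_adicCompletionPrime 3 S η
    D.primes (fun ℓ hℓ => hD.zpowers_eq_top hℓ)
  -- `h0` at both depths from `Irr(E[3])`
  have h0 : ∀ r : Finset (HeightOneSpectrum (𝓞 ℚ)), (↑r : Set _) ⊆ D.primes →
      ∀ P : WeierstrassCurve.geomTorsion W (((3 : ℕ) : ℤ) ^ k * ((3 : ℕ) : ℤ)),
        (∀ u : (𝓛).level ⊥ r, (u : absoluteGaloisGroup ℚ) • P = P) → P = 0 :=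
    fun r _ P hP => geomTorsion_eq_zero_of_fixed_level W 3 S (by norm_num) hirr hmk ⊥ r P hP
  have h0'' : ∀ r : Finset (HeightOneSpectrum (𝓞 ℚ)), (↑r : Set _) ⊆ D.primes →
      ∀ P : WeierstrassCurve.geomTorsion W (((3 : ℕ) : ℤ) ^ m * ((3 : ℕ) : ℤ)),
        (∀ u : (𝓛).level ⊥ r, (u : absoluteGaloisGroup ℚ) • P = P) → P = 0 :=
    fun r _ P hP => geomTorsion_eq_zero_of_fixed_level W 3 S (by norm_num) hirr hmm ⊥ r P hP
  -- the two families (D2), same generators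
  obtain ⟨Φ, comm, hΦ, κ, hκ0, hκ⟩ := exists_derivativeFamily W 3 S hc red (Nat.succ_pos k) hM e hec he
    einv hic h₁ h₂ D.primes hPr hKolk σ hσ h0
  obtain ⟨Φ'', comm'', hΦ'', κ'', -, hκ''⟩ := exists_derivativeFamily W 3 S hc red'' (Nat.succ_pos m)
    hM'' e'' hec'' he'' einv'' hic'' h₁'' h₂'' D.primes hPr hKol σ hσ h0''
  refine ⟨σ, Φ, comm, κ, hσI, hσχ, hΦ, ?_, hκ0, fun r hr => (hκ r hr).1⟩
  refine isKolyvaginSystem_derivativeFamily_of_transverse_eq W 3 S (by norm_num) hc red hred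
    (Nat.succ_pos k) hM hmk e hec he einv hic h₁ h₂ D hT hD hPr hKolk σ (fun ℓ _ => hσI ℓ)
    (fun ℓ _ => hσχ ℓ) hσ h0 Φ hΦ comm κ hκ0 (fun r hr => (hκ r hr).1) (propagatedSelmerStructure W 3 k)
    (fun w hw hne => (propagatedSelmerStructure_inr_eq_unramifiedSubgroup W 3 k
      (WeierstrassCurve.natCast_not_mem_asIdeal_of_primesEquiv_ne Fact.out hne) hw).ge)
    fun d hd w hwd hw => ?_
  by_cases hw3 : ((primesEquiv w : Nat.Primes) : ℕ) = 3
  · -- the place `3`: §1 with the deeper family (any reduction type, `hstab` at `w`)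
    exact localization_mem_propagatedSelmerStructure_three_of_res_eq_deriv_of_stable
      W (W.continuous_galoisRepTate_holds 3) (hstab w hw3) hkm r hr ((𝓛).level ⊥ d) σ
      (fun ℓ => ((primesEquiv ℓ : Nat.Primes) : ℕ) - 1) d (comm'' d) (comm d)
      (c ⊥ ⟨d, fun _ hq => hPr (hd (Finset.mem_coe.2 hq))⟩)
      ((Φ'' d).comp (𝐫⟦red'', T'', ((𝓛).level ⊥ d)⟧).hom.toAddMonoidHom)
      (fun φ ψ hψ => comp_map_red_oneCocycleClass W red'' e'' hcomp'' _ (Φ'' d) (hΦ'' d) φ ψ hψ)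
      ((Φ d).comp (𝐫⟦red, T', ((𝓛).level ⊥ d)⟧).hom.toAddMonoidHom)
      (fun φ ψ hψ => comp_map_red_oneCocycleClass W red e hcomp _ (Φ d) (hΦ d) φ ψ hψ)
      (κ'' d) (hκ'' d hd).1 ⟨κ d, (hκ d hd).1, fun κ₁ h => (hκ d hd).2 κ₁ h⟩ (κ d) (hκ d hd).1
  · -- a bad place `w ≠ 3` (anomalous or not): THEOREM B-u road, no certificate
    have hcompk : ∀ a : W.tateModule 3, tateToTorsion W 3 k a = e (red.hom a) := fun a =>
      Subtype.ext (by rw [coe_tateToTorsion_apply]; exact (hcomp a).symm)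
    obtain ⟨Φ₀, hΦ₀⟩ := exists_addEquiv_oneCocycleClass T'.toTopRep
      (W.torsionGaloisModule (((3 : ℕ) : ℤ) ^ k * ((3 : ℕ) : ℤ))).toTopRep e hec he einv hic h₁ h₂
    have hκX := resSubgroup_symm_eq_noncommProd_deriv T'.toTopRep
      (W.torsionGaloisModule (((3 : ℕ) : ℤ) ^ k * ((3 : ℕ) : ℤ))).toTopRep e hec he einv h₁ h₂ ((𝓛).level ⊥ d)
      Φ₀ hΦ₀ (Φ d) (hΦ d) σ _ d
      (pairwise_commute_deriv (L := 𝓛) (T' := T') ⊥ d σ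
        (fun ℓ => ((primesEquiv ℓ : Nat.Primes) : ℕ) - 1)) (comm d) _ (κ d) ((hκ d hd).1)
    rw [← Φ₀.apply_symm_apply (κ d)]
    exact localization_mem_propagatedSelmerStructure_of_res_eq_deriv_of_unramified W k hc red e hec
      (fun g x => he g x) hcompk Φ₀.toAddMonoidHom (fun φ ψ h => hΦ₀ φ ψ h)
      ⟨d, fun _ hq => hPr (hd (Finset.mem_coe.2 hq))⟩ σ Fr (hσ d hd).1 (hσ d hd).2.1 (hσ d hd).2.2
      (fun ℓ _ => hFr ℓ)
      (fun ℓ hℓ s _ _ =>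
        CyclotomicLevel.Rat.not_subgroupIsUnramifiedAt_cyclotomicLevelsRat_level_insert 3 S ⊥
          (Derivative.Rat.ne_two_of_isKolyvaginPrime W 3 (Nat.succ_pos k)
            (hKolk ℓ (hd (Finset.mem_coe.2 hℓ)))) s)
      (fun ℓ hℓ v => natCast_sub_one_smul_eq_zero_of_isKolyvaginPrime W 3 k hM
        (hKolk ℓ (hd (Finset.mem_coe.2 hℓ))) v)
      (fun ℓ hℓ v => eval_one_rubinEulerFactor_smul_eq_zero_of_isKolyvaginPrime W 3 k hM
        (hKolk ℓ (hd (Finset.mem_coe.2 hℓ))) (hFr ℓ) v)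
      _ (eq_zero_of_forall_level_fixed_of_equiv W 3 k e he einv h₁ ((𝓛).level ⊥ d) (h0 d hd))
      (Φ₀.symm (κ d)) hκX w hwd
      (fun s hs 𝔓 h𝔓 => hur ⊥ ⟨s, fun _ hq => hPr (hd (Finset.mem_coe.2 (hs hq)))⟩ w hw3 𝔓 h𝔓)

/-- **The `E[3^{k+1}]_{ℤ₃}` reading (D6b-u) at any reduction type at `3`**: binders = gen 5's
`…_hasAdditiveReductionAt_torsionCoeff_of_unramified` with `hadd` ↦ `hstab` (level `N₀`), depth
`k + N₀ ≤ m`, primes of level `m + 1`, T-DER-BP's reduction map `r`/`hr`, and `hur` (ZetaBody (C2)).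
[cite: MazurRubin2004, App. A Prop. A.2, Remark A.5 and Thm. 3.2.4] [cite: Sakamoto2024, Def. 4.1 (p. 926)] -/
theorem exists_isKolyvaginSystem_propagatedSelmerStructure_three_torsionCoeff_of_stable_of_unramified
    {c : ∀ (i : ℕ) (r : (𝓛).Ideals), H1 T∞ ((𝓛).level i r.1)}
    (hc : IsEulerSystem 𝓛 T∞ 3 c) {k m N₀ : ℕ} (hkm : k + N₀ ≤ m)
    (r : (W.torsionGaloisModule (((3 : ℕ) : ℤ) ^ m * ((3 : ℕ) : ℤ))).toContRepresentation →ⁱL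
      (W.torsionGaloisModule (((3 : ℕ) : ℤ) ^ k * ((3 : ℕ) : ℤ))).toContRepresentation)
    (hr : ∀ x : geomTorsion W (((3 : ℕ) : ℤ) ^ m * ((3 : ℕ) : ℤ)),
      ((r x : geomTorsion W (((3 : ℕ) : ℤ) ^ k * ((3 : ℕ) : ℤ))) : geomPoints W) =
        (((3 : ℕ) : ℤ) ^ (m - k)) • (x : geomPoints W))
    (hirr : W.HasIrreducibleModPGaloisRep 3)
    (hstab : ∀ v : HeightOneSpectrum (𝓞 ℚ), ((primesEquiv v : Nat.Primes) : ℕ) = 3 →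
      ∀ P : (W.baseChange (v.adicCompletion ℚ)).toAffine.Point, 3 ^ (N₀ + 1) • P = 0 → 3 ^ N₀ • P = 0)
    (D : KolyvaginDatum (W.torsionGaloisModule (((3 : ℕ) : ℤ) ^ k * ((3 : ℕ) : ℤ))))
    (hT : D.transverse = cyclotomicTransverse (W.torsionGaloisModule (((3 : ℕ) : ℤ) ^ k * ((3 : ℕ) : ℤ))))
    {η : (ℓ : HeightOneSpectrum (𝓞 ℚ)) → (ZMod (Ideal.absNorm ℓ.asIdeal))ˣ}
    (hD : D.HasCanonicalComparison (3 ^ (k + 1)) η)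
    (hPr : D.primes ⊆ (𝓛).primes)
    (hKol : ∀ ℓ ∈ D.primes, Kato.IsKolyvaginPrime W 3 (m + 1) ((primesEquiv ℓ : Nat.Primes) : ℕ))
    -- (C2): every class of the Euler system is UNRAMIFIED AWAY FROM `3` at class level (`ZetaBody` (C2))
    (hur : ∀ (i : ℕ) (r : (𝓛).Ideals) (v : HeightOneSpectrum (𝓞 ℚ)), ((primesEquiv v : Nat.Primes) : ℕ) ≠ 3 →
      ∀ 𝔓 ∈ v.primesAbove,
        resLe (T∞).toTopRep
          (inf_le_left : (𝓛).level i r.1 ⊓ 𝔓.inertia (absoluteGaloisGroup ℚ) ≤ (𝓛).level i r.1) 1 (c i r) = 0) :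
    letI := TorsionCoeff.torsionBy.padicIntModule 3 (k + 1) (WeierstrassCurve.geomPoints W)
    ∃ (σ : HeightOneSpectrum (𝓞 ℚ) → absoluteGaloisGroup ℚ)
      (Φ : ∀ r : Finset (HeightOneSpectrum (𝓞 ℚ)),
        continuousCohomology 1 (subgroupRep (torsionRepPadicInt W 3 (k + 1)).toTopRep ((𝓛).level ⊥ r)) →+
          continuousCohomology 1 (subgroupRep
            (W.torsionGaloisModule (((3 : ℕ) : ℤ) ^ k * ((3 : ℕ) : ℤ))).toTopRep ((𝓛).level ⊥ r)))
      (comm : ∀ r : Finset (HeightOneSpectrum (𝓞 ℚ)),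
        ((r : Finset _) : Set (HeightOneSpectrum (𝓞 ℚ))).Pairwise fun a b =>
          Commute (𝐃ℤ⟦(W.torsionGaloisModule (((3 : ℕ) : ℤ) ^ k * ((3 : ℕ) : ℤ))).toTopRep, ((𝓛).level ⊥ r), σ⟧ a)
            (𝐃ℤ⟦(W.torsionGaloisModule (((3 : ℕ) : ℤ) ^ k * ((3 : ℕ) : ℤ))).toTopRep, ((𝓛).level ⊥ r), σ⟧ b))
      (κ : Finset (HeightOneSpectrum (𝓞 ℚ)) →
        galoisCohomology (W.torsionGaloisModule (((3 : ℕ) : ℤ) ^ k * ((3 : ℕ) : ℤ))) 1),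
      (∀ ℓ, σ ℓ ∈ (adicCompletionPrime ℚ ℓ).inertia (absoluteGaloisGroup ℚ)) ∧
      (∀ ℓ, modNCyclotomicCharacter ℚ (Ideal.absNorm ℓ.asIdeal) (σ ℓ) = η ℓ) ∧
      (∀ r, ∀ (φ : contOneCocycles (subgroupRep (torsionRepPadicInt W 3 (k + 1)).toTopRep ((𝓛).level ⊥ r)))
        (ψ : contOneCocycles (subgroupRep
          (W.torsionGaloisModule (((3 : ℕ) : ℤ) ^ k * ((3 : ℕ) : ℤ))).toTopRep ((𝓛).level ⊥ r))),
        (∀ g, ψ.1 g = AddSubgroup.inclusion (geomTorsion_pow_succ_eq W 3 k).le (φ.1 g)) →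
          Φ r (oneCocycleClass _ φ) = oneCocycleClass _ ψ) ∧
      D.IsKolyvaginSystem (propagatedSelmerStructure W 3 k) κ ∧
      (∀ r : Finset (HeightOneSpectrum (𝓞 ℚ)), ¬ (↑r : Set _) ⊆ D.primes → κ r = 0) ∧
      ∀ (r : Finset (HeightOneSpectrum (𝓞 ℚ))) (hr : (↑r : Set _) ⊆ D.primes),
        resSubgroup (W.torsionGaloisModule (((3 : ℕ) : ℤ) ^ k * ((3 : ℕ) : ℤ))).toTopRep ((𝓛).level ⊥ r) 1
            (κ r) =
          (r.noncommProd 𝐃ℤ⟦(W.torsionGaloisModule (((3 : ℕ) : ℤ) ^ k * ((3 : ℕ) : ℤ))).toTopRep,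
              ((𝓛).level ⊥ r), σ⟧ (comm r))
            (Φ r (ContinuousCohomology.map (ContinuousMonoidHom.id _)
              (X := subgroupRep T∞.toTopRep ((𝓛).level ⊥ r))
              (Y := subgroupRep (torsionRepPadicInt W 3 (k + 1)).toTopRep ((𝓛).level ⊥ r))
              ((TopRep.resFunctor ((𝓛).level ⊥ r).subtype).map 𝐫𝐞𝐝⟦k + 1⟧) 1
              (c ⊥ ⟨r, fun _ hq => hPr (hr (Finset.mem_coe.2 hq))⟩))) := by
  letI := TorsionCoeff.torsionBy.padicIntModule 3 (k + 1) (WeierstrassCurve.geomPoints W)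
  letI := TorsionCoeff.torsionBy.padicIntModule 3 (m + 1) (WeierstrassCurve.geomPoints W)
  have hred : ∀ j : ℕ, Function.Surjective (𝐫𝐞𝐝⟦j⟧).hom := fun j y => by
    obtain ⟨a, ha⟩ := W.proj_surjective_of_isAlgClosed_holds 3 j y.2
    exact ⟨a, Subtype.ext ha⟩
  exact exists_isKolyvaginSystem_propagatedSelmerStructure_three_of_stable_of_unramified W S hc hkm
    𝐫𝐞𝐝⟦k + 1⟧ (hred (k + 1)) (fun x => pow_smul_eq_zero 3 (k + 1) _ x)
    (AddSubgroup.inclusion (geomTorsion_pow_succ_eq W 3 k).le : _ →+ _) continuous_of_discreteTopology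
    (fun _ _ => rfl) (AddSubgroup.inclusion (geomTorsion_pow_succ_eq W 3 k).ge : _ →+ _)
    continuous_of_discreteTopology (fun x => Subtype.ext rfl) (fun y => Subtype.ext rfl) (fun _ => rfl)
    𝐫𝐞𝐝⟦m + 1⟧ (fun x => pow_smul_eq_zero 3 (m + 1) _ x)
    (AddSubgroup.inclusion (geomTorsion_pow_succ_eq W 3 m).le : _ →+ _) continuous_of_discreteTopology
    (fun _ _ => rfl) (AddSubgroup.inclusion (geomTorsion_pow_succ_eq W 3 m).ge : _ →+ _)
    continuous_of_discreteTopology (fun x => Subtype.ext rfl) (fun y => Subtype.ext rfl) (fun _ => rfl)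
    r hr hirr hstab D hT hD hPr hKol hur

end Summit.BirchSwinnertonDyer.BirchSwinnertonDyer.Theorems.KimAtThreeDeepUpperKolyvaginStableThree

end
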